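import Literature.Probability.LatticeModels.LocalPerturbationPolymerGas
import HarnessLib

/-!
# Local perturbations of a finite-range dependent reference process: the cluster expansion of
# `log Z`

`Literature/Probability/LatticeModels/`; the Kotecký–Preiss layer on top of
`LocalPerturbationPolymerGas` (cells `p : V`, symmetric adjacency `R` with at most `Δ` neighbours
listed by `nbr`, local σ-algebras, finite-range dependence, cell factors `‖g p‖ ≤ ε`:
`IsLocalPerturbation μ R 𝓕 g ε`; `Z(C) = pertZ μ g C = Ξ(𝒫(C); M)`).

* `geomInc_kp_sum_le`, `isKPVolume_geomInc` (**geometric polymers satisfy the Kotecký–Preiss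
  condition**): for activities supported on `R`-connected cell sets with `‖z X‖ ≤ ε^{#X}` and
  `e^{1+τ} ε (Δ+1)² ≤ 1/2`, `Σ_{Y ≁ X} ‖z Y‖ e^{(1+τ) #Y} ≤ #X (Δ+1) 2e^{1+τ}ε ≤ #X`, i.e. the
  finite-volume KP condition with size function `a(X) = #X` (and decay weight `d(X) = τ #X`) on
  every finite family of polymers (the tree's lattice-animal bound `sum_kpWeight_le_of_touches`).
* For a local perturbation under Dobrushin/KP smallness `e ε (Δ+1)² ≤ 1/2` (`R` symmetric as an
  instance `[Std.Symm R]`, so that the tree's KP lemmas — stated for `[Std.Refl inc] [Std.Symm inc]`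
  — apply to the geometric incompatibility `GeomInc R`):
  - `pertLogZ μ g R C` — the Kotecký–Preiss logarithm of `Z(C)` — satisfies
    `exp (pertLogZ) = Z(C)` (`exp_pertLogZ`) and **the cluster expansion**
    `pertLogZ = Σ_{𝒞 ⊆ 𝒫(C)} Φ^T(𝒞)` (`pertLogZ_eq_sum_truncatedWeight`; [KP86, (2)]);
  - **two-sided exclusion cost** `exp (-#D (Δ+1) 2eε) ≤ ‖Z(C ∖ D)/Z(C)‖` (`exp_neg_le_norm_pertZ_sdiff_div`,
    the lower companion of `norm_pertZ_sdiff_div_le`);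
  - **pinned cluster sums are `O(ε)`** (`sum_norm_truncatedWeight_touching_le`):
    `Σ_{𝒞 ⊆ 𝒫(C), 𝒞 ≁ X} ‖Φ^T(𝒞)‖ ≤ #X (Δ+1) 2eε` for every cell set `X` — the LINEAR form of
    [KP86, (4)] obtained from the tree's derivative bound `touchSum_le_of_forall_scaleAt`;
  - **extensivity with an `O(ε)` density** (`norm_pertLogZ_le`): `‖log Z(C)‖ ≤ #C (Δ+1) 2eε`,
    uniformly in the volume.

Everything is proved (all inputs are the tree's `ClusterExpansion*` / `PolymerGas*` files).

## References

* R. Kotecký, D. Preiss, *Cluster expansion for abstract polymer models*, Comm. Math. Phys. 103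
  (1986) 491–498, Theorem p. 492 with (1), (2), (4). [KoteckyPreiss1986]
* S. Friedli, Y. Velenik, *Statistical Mechanics of Lattice Systems*, CUP (2017), Thm. 5.4,
  §5.7.1. [FriedliVelenik2017]
-/

noncomputable section

open _root_.MeasureTheory _root_.ProbabilityTheory Finset
open scoped BigOperators

namespace Literature.Probability.LatticeModels

variable {V : Type*}

/-! ### The geometric incompatibility as reflexive/symmetric instances -/

section Instances

variable {R : V → V → Prop}

/-- The geometric incompatibility is reflexive. [folklore] -/
instance instReflGeomInc : Std.Refl (GeomInc R) := ⟨fun X => geomInc_refl R X⟩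

/-- The geometric incompatibility is symmetric when the adjacency is. [folklore] -/
instance instSymmGeomInc [Std.Symm R] : Std.Symm (GeomInc R) :=
  ⟨fun _ _ h => geomInc_symm R (fun x y hxy => Std.Symm.symm x y hxy) h⟩

end Instances

/-! ### Geometric polymers satisfy the Kotecký–Preiss condition -/

section GeometricKP

variable [DecidableEq V] {R : V → V → Prop} [DecidableRel R] {nbr : V → Finset V} {Δ : ℕ}

/-- **The KP sums of geometric polymers.** For activities supported on `R`-connected sets with
`‖z X‖ ≤ ε^{#X}`, `τ ≥ 0` and `e^{1+τ} ε (Δ+1)² ≤ 1/2`: for every cell set `X` and every finite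
family `𝒩` of polymers geometrically incompatible with `X`,
`Σ_{Y ∈ 𝒩} ‖z Y‖ e^{#Y + τ #Y} ≤ #X (Δ+1) · 2 e^{1+τ} ε`.
[cite: KoteckyPreiss1986, (1); FriedliVelenik2017, Thm. 5.4] -/
theorem geomInc_kp_sum_le (hR : ∀ x y, R x y → R y x) (hΔ : ∀ x, (nbr x).card ≤ Δ)
    (hnbr : ∀ x y, R x y → y ∈ nbr x) {ε τ : ℝ} (hε : 0 ≤ ε)
    (hsmall : Real.exp (1 + τ) * ε * ((Δ : ℝ) + 1) ^ 2 ≤ 1 / 2) (z : Finset V → ℂ)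
    (hz0 : ∀ X, ¬ IsRConnected R X → z X = 0) (hz : ∀ X, ‖z X‖ ≤ ε ^ X.card)
    (X : Finset V) (𝒩 : Finset (Finset V)) (h𝒩 : ∀ Y ∈ 𝒩, GeomInc R Y X) :
    ∑ Y ∈ 𝒩, ‖z Y‖ * Real.exp ((Y.card : ℝ) + τ * Y.card) ≤
      X.card * ((Δ : ℝ) + 1) * (2 * (Real.exp (1 + τ) * ε)) := by
  set lam : ℝ := Real.exp (1 + τ) * ε with hlam_def
  have hlam : 0 ≤ lam := mul_nonneg (Real.exp_pos _).le hε
  have hsmall' : ((Δ : ℝ) + 1) ^ 2 * lam ≤ 1 / 2 := by rw [hlam_def]; linarith [hsmall]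
  have hterm : ∀ Y, ‖z Y‖ * Real.exp ((Y.card : ℝ) + τ * Y.card) ≤ kpWeight R lam Y := by
    intro Y
    by_cases hc : IsRConnected R Y
    · have hμ : kpWeight R lam Y = lam ^ Y.card := by simp [kpWeight, hc]
      rw [hμ, hlam_def, mul_pow, mul_comm (Real.exp (1 + τ) ^ Y.card), ← Real.exp_nat_mul,
        show ((Y.card : ℝ) + τ * Y.card) = Y.card * (1 + τ) by ring]
      exact mul_le_mul_of_nonneg_right (hz Y) (Real.exp_nonneg _)
    · rw [hz0 Y hc, norm_zero, zero_mul]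
      exact kpWeight_nonneg R hlam Y
  refine (sum_le_sum fun Y _ => hterm Y).trans ?_
  refine sum_kpWeight_le_of_touches hR hΔ hnbr hlam hsmall' X 𝒩 fun Y hY => ?_
  rcases geomInc_symm R hR (h𝒩 Y hY) with h | h
  · exact Or.inl h.symm
  · exact Or.inr h

/-- Under `e^{1+τ} ε (Δ+1)² ≤ 1/2` one has `(Δ+1) 2 e^{1+τ} ε ≤ 1`. [folklore] -/
theorem two_mul_exp_mul_le_one {ε τ : ℝ} {Δ : ℕ} (hε : 0 ≤ ε)
    (hsmall : Real.exp (1 + τ) * ε * ((Δ : ℝ) + 1) ^ 2 ≤ 1 / 2) :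
    ((Δ : ℝ) + 1) * (2 * (Real.exp (1 + τ) * ε)) ≤ 1 := by
  have hΔ1 : (1 : ℝ) ≤ (Δ : ℝ) + 1 := by
    have : (0 : ℝ) ≤ Δ := Nat.cast_nonneg Δ
    linarith
  have hlam : 0 ≤ Real.exp (1 + τ) * ε := mul_nonneg (Real.exp_pos _).le hε
  nlinarith [hsmall, hlam]

/-- **Geometric polymers form a Kotecký–Preiss volume** (size function `a(X) = #X`, decay weight
`d(X) = τ #X`): under `e^{1+τ} ε (Δ+1)² ≤ 1/2`, every finite family of polymers `𝒜` satisfies the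
finite-volume KP hypothesis `Σ_{Y ∈ 𝒜, Y ≁ X} ‖z Y‖ e^{#Y + τ#Y} ≤ #X` for `X ∈ 𝒜`.
[cite: KoteckyPreiss1986, (1)] -/
theorem geomInc_kp_hypothesis (hR : ∀ x y, R x y → R y x) (hΔ : ∀ x, (nbr x).card ≤ Δ)
    (hnbr : ∀ x y, R x y → y ∈ nbr x) {ε τ : ℝ} (hε : 0 ≤ ε)
    (hsmall : Real.exp (1 + τ) * ε * ((Δ : ℝ) + 1) ^ 2 ≤ 1 / 2) (z : Finset V → ℂ)
    (hz0 : ∀ X, ¬ IsRConnected R X → z X = 0) (hz : ∀ X, ‖z X‖ ≤ ε ^ X.card)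
    (𝒜 : Finset (Finset V)) :
    ∀ X ∈ 𝒜, ∑ Y ∈ 𝒜 with GeomInc R Y X,
      ‖z Y‖ * Real.exp ((Y.card : ℝ) + τ * (Y.card : ℝ)) ≤ (X.card : ℝ) := by
  intro X _
  refine (geomInc_kp_sum_le hR hΔ hnbr hε hsmall z hz0 hz X _ fun Y hY => (mem_filter.1 hY).2).trans ?_
  calc (X.card : ℝ) * ((Δ : ℝ) + 1) * (2 * (Real.exp (1 + τ) * ε))
      = X.card * (((Δ : ℝ) + 1) * (2 * (Real.exp (1 + τ) * ε))) := by ring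
    _ ≤ X.card * 1 := mul_le_mul_of_nonneg_left (two_mul_exp_mul_le_one hε hsmall) (Nat.cast_nonneg _)
    _ = X.card := mul_one _

/-- The finite-volume KP condition `IsKPVolume (GeomInc R) z (#·) 𝒜` for geometric polymers
under `e ε (Δ+1)² ≤ 1/2` (the case `τ = 0`). [cite: KoteckyPreiss1986, (1)] -/
theorem isKPVolume_geomInc (hR : ∀ x y, R x y → R y x) (hΔ : ∀ x, (nbr x).card ≤ Δ)
    (hnbr : ∀ x y, R x y → y ∈ nbr x) {ε : ℝ} (hε : 0 ≤ ε)
    (hsmall : Real.exp 1 * ε * ((Δ : ℝ) + 1) ^ 2 ≤ 1 / 2) (z : Finset V → ℂ)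
    (hz0 : ∀ X, ¬ IsRConnected R X → z X = 0) (hz : ∀ X, ‖z X‖ ≤ ε ^ X.card)
    (𝒜 : Finset (Finset V)) :
    IsKPVolume (GeomInc R) z (fun X => (X.card : ℝ)) 𝒜 := by
  intro X hX
  have h := geomInc_kp_hypothesis hR hΔ hnbr hε (τ := 0) (by simpa using hsmall) z hz0 hz 𝒜 X hX
  refine le_trans (sum_le_sum fun Y _ => ?_) h
  unfold kpTerm
  simp

end GeometricKP

/-! ### The cluster expansion of `log Z(C)` for a local perturbation -/

section LogZ

variable [DecidableEq V] {Ω : Type*} {mΩ : MeasurableSpace Ω} {μ : Measure Ω}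
  {R : V → V → Prop} [DecidableRel R] [Std.Symm R] {𝓕 : V → MeasurableSpace Ω} {g : V → Ω → ℂ}
  {ε : ℝ} {nbr : V → Finset V} {Δ : ℕ}

omit [DecidableEq V] [DecidableRel R] in
/-- Symmetry of `R` from the instance. [folklore] -/
theorem symm_of_inst : ∀ x y, R x y → R y x := fun x y h => Std.Symm.symm x y h

omit [DecidableRel R] [Std.Symm R] in
/-- The **Kotecký–Preiss logarithm of the perturbed partition function** `log Z(C)`: the KP
branch of the logarithm of the polymer gas `Ξ(𝒫(C); M)`. [cite: KoteckyPreiss1986, §2] -/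
def pertLogZ (μ : Measure Ω) (g : V → Ω → ℂ) (R : V → V → Prop) [DecidableRel R]
    (C : Finset V) : ℂ :=
  polymerLogZ (GeomInc R) (connActivity R μ g) (rconnSubsets R C)

/-- The truncated activities of a local perturbation form a KP volume on every finite family of
polymers, under `e ε (Δ+1)² ≤ 1/2`. [cite: KoteckyPreiss1986, (1)] -/
theorem isKPVolume_connActivity [IsProbabilityMeasure μ] (hΔ : ∀ x, (nbr x).card ≤ Δ)
    (hnbr : ∀ x y, R x y → y ∈ nbr x) (h : IsLocalPerturbation μ R 𝓕 g ε)
    (hsmall : Real.exp 1 * ε * ((Δ : ℝ) + 1) ^ 2 ≤ 1 / 2) (𝒜 : Finset (Finset V)) :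
    IsKPVolume (GeomInc R) (connActivity R μ g) (fun X => (X.card : ℝ)) 𝒜 :=
  isKPVolume_geomInc symm_of_inst hΔ hnbr h.nonneg hsmall _ (fun X hX => by simp [connActivity, hX])
    (fun X => by
      by_cases hX : IsRConnected R X
      · simpa [connActivity, hX] using norm_cellActivity_le h X
      · simp only [connActivity, hX, if_false, norm_zero]
        exact pow_nonneg h.nonneg _) 𝒜

/-- **`exp (log Z(C)) = Z(C)`** under `e ε (Δ+1)² ≤ 1/2`.
[cite: KoteckyPreiss1986, §2 and Theorem p. 492] -/
theorem exp_pertLogZ [IsProbabilityMeasure μ] (hΔ : ∀ x, (nbr x).card ≤ Δ)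
    (hnbr : ∀ x y, R x y → y ∈ nbr x) (h : IsLocalPerturbation μ R 𝓕 g ε)
    (hsmall : Real.exp 1 * ε * ((Δ : ℝ) + 1) ^ 2 ≤ 1 / 2) (C : Finset V) :
    Complex.exp (pertLogZ μ g R C) = pertZ μ g C := by
  rw [pertZ_eq_polymerPartitionFunction symm_of_inst h C,
    ← polymerPartitionFunction_connActivity fun X hX => (mem_rconnSubsets.1 hX).2]
  exact exp_polymerLogZ_of_kp (isKPVolume_connActivity hΔ hnbr h hsmall _) subset_rfl

omit [Std.Symm R] in
/-- **The cluster expansion** `log Z(C) = Σ_{𝒞 ⊆ 𝒫(C)} Φ^T(𝒞)` ([KP86, (2)]; the truncated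
functional `Φ^T = truncatedWeight` vanishes off clusters, `truncatedWeight_eq_zero_of_kp`).
[cite: KoteckyPreiss1986, (2)] -/
theorem pertLogZ_eq_sum_truncatedWeight (C : Finset V) :
    pertLogZ μ g R C = ∑ 𝒞 ∈ (rconnSubsets R C).powerset,
      truncatedWeight (GeomInc R) (connActivity R μ g) 𝒞 :=
  polymerLogZ_eq_sum_truncatedWeight _ _

/-- **Two-sided exclusion cost**: under `e ε (Δ+1)² ≤ 1/2`,
`exp (-#D (Δ+1) 2eε) ≤ ‖Z(C ∖ D)/Z(C)‖` (with `norm_pertZ_sdiff_div_le` this pins the ratio in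
the annulus `e^{∓ #D (Δ+1) 2eε}`). [cite: KoteckyPreiss1986, Theorem p. 492 with (5)] -/
theorem exp_neg_le_norm_pertZ_sdiff_div [IsProbabilityMeasure μ] (hΔ : ∀ x, (nbr x).card ≤ Δ)
    (hnbr : ∀ x y, R x y → y ∈ nbr x) (h : IsLocalPerturbation μ R 𝓕 g ε)
    (hsmall : Real.exp 1 * ε * ((Δ : ℝ) + 1) ^ 2 ≤ 1 / 2) (C D : Finset V) :
    Real.exp (-(D.card * ((Δ : ℝ) + 1) * (2 * (Real.exp 1 * ε)))) ≤
      ‖pertZ μ g (C \ D) / pertZ μ g C‖ := by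
  have hR : ∀ x y, R x y → R y x := symm_of_inst
  set M : Finset (Finset V) := (rconnSubsets R C).filter fun X => (X ∩ D).Nonempty with hM
  rw [pertZ_eq_polymerPartitionFunction hR h C, pertZ_eq_polymerPartitionFunction hR h (C \ D),
    rconnSubsets_sdiff C D,
    ← polymerPartitionFunction_connActivity fun X hX => (mem_rconnSubsets.1 hX).2,
    ← polymerPartitionFunction_connActivity fun X hX => (mem_rconnSubsets.1 (mem_sdiff.1 hX).1).2]
  refine le_trans (Real.exp_le_exp.2 (neg_le_neg ?_))
    (le_norm_polymerPartitionFunction_sdiff_div_of_kp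
      (isKPVolume_connActivity hΔ hnbr h hsmall (rconnSubsets R C)) subset_rfl (filter_subset _ _))
  -- `Σ_{X ∈ M} ‖z X‖ e^{#X} ≤ #D (Δ+1) 2eε`
  have hz0 : ∀ X, ¬ IsRConnected R X → connActivity R μ g X = 0 := fun X hX => by
    simp [connActivity, hX]
  have hz : ∀ X, ‖connActivity R μ g X‖ ≤ ε ^ X.card := fun X => by
    by_cases hX : IsRConnected R X
    · simpa [connActivity, hX] using norm_cellActivity_le h X
    · simp only [connActivity, hX, if_false, norm_zero]; exact pow_nonneg h.nonneg _
  have hsum := geomInc_kp_sum_le hR hΔ hnbr h.nonneg (τ := 0) (by simpa using hsmall)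
    (connActivity R μ g) hz0 hz D M fun Y hY => by
      obtain ⟨q, hq⟩ := (mem_filter.1 hY).2
      exact Or.inr ⟨q, (mem_inter.1 hq).1, q, (mem_inter.1 hq).2, Or.inl rfl⟩
  simp only [zero_mul, add_zero] at hsum
  refine le_trans (sum_le_sum fun X _ => ?_) (by simpa using hsum)
  unfold kpTerm
  rfl

/-- **Pinned cluster sums are `O(ε)`** (the linear form of [KP86, (4)]): under
`e ε (Δ+1)² ≤ 1/2`, for every cell set `X`,
`Σ_{𝒞 ⊆ 𝒫(C), 𝒞 ≁ X} ‖Φ^T(𝒞)‖ ≤ #X (Δ+1) 2eε`.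
[cite: KoteckyPreiss1986, Theorem p. 492, estimate (4) and §3 (12)] -/
theorem sum_norm_truncatedWeight_touching_le [IsProbabilityMeasure μ] (hΔ : ∀ x, (nbr x).card ≤ Δ)
    (hnbr : ∀ x y, R x y → y ∈ nbr x) (h : IsLocalPerturbation μ R 𝓕 g ε)
    (hsmall : Real.exp 1 * ε * ((Δ : ℝ) + 1) ^ 2 ≤ 1 / 2) (C X : Finset V) :
    ∑ 𝒞 ∈ (rconnSubsets R C).powerset with KPTouches (GeomInc R) 𝒞 X,
        ‖truncatedWeight (GeomInc R) (connActivity R μ g) 𝒞‖ ≤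
      X.card * ((Δ : ℝ) + 1) * (2 * (Real.exp 1 * ε)) := by
  have hR : ∀ x y, R x y → R y x := symm_of_inst
  set L := rconnSubsets R C with hL
  set w := connActivity R μ g with hw
  have hz0 : ∀ Y, ¬ IsRConnected R Y → w Y = 0 := fun Y hY => by simp [hw, connActivity, hY]
  have hz : ∀ Y, ‖w Y‖ ≤ ε ^ Y.card := fun Y => by
    by_cases hY : IsRConnected R Y
    · simpa [hw, connActivity, hY] using norm_cellActivity_le h Y
    · simp only [hw, connActivity, hY, if_false, norm_zero]; exact pow_nonneg h.nonneg _
  -- the finite-volume KP hypothesis with `a = #·`, `d = 0`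
  have h1 : ∀ γ ∈ L, ∑ γ' ∈ L with GeomInc R γ' γ,
      ‖w γ'‖ * Real.exp ((γ'.card : ℝ) + (fun _ : Finset V => (0 : ℝ)) γ') ≤ (γ.card : ℝ) := by
    intro γ hγ
    have := geomInc_kp_hypothesis hR hΔ hnbr h.nonneg (τ := 0) (by simpa using hsmall) w hz0 hz L γ hγ
    simpa using this
  have ha : ∀ γ : Finset V, 0 ≤ (γ.card : ℝ) := fun γ => Nat.cast_nonneg _
  have hd : ∀ γ : Finset V, 0 ≤ (fun _ : Finset V => (0 : ℝ)) γ := fun _ => le_rfl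
  have hKP : IsKPVolume (GeomInc R) w (fun X => (X.card : ℝ)) L :=
    isKPVolume_connActivity hΔ hnbr h hsmall L
  -- (S) along the path `Φ_t` from the real induction, then the derivative bound (12)
  have hS : ∀ t ∈ Set.Icc (0 : ℝ) 1, ∀ δ ∈ L, GeomInc R δ X →
      touchSum (GeomInc R) (scaledActivity w (scaleAt (GeomInc R) (fun _ => (1 : ℝ)) X t))
        (fun _ => (0 : ℝ)) L δ ≤ (δ.card : ℝ) := by
    intro t ht δ hδ _
    have hc : scaleAt (GeomInc R) (fun _ => (1 : ℝ)) X t ∈ multCube (Finset V) 1 :=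
      mem_multCube.2 fun δ' => scaleAt_mem_Icc (fun _ => ⟨zero_le_one, le_rfl⟩) X ht δ'
    have := touchSum_smul_le_of_kp ha hd h1 1 ⟨zero_le_one, le_rfl⟩ _ hc δ hδ
    rwa [one_smul] at this
  have hmain := touchSum_le_of_forall_scaleAt (inc := GeomInc R) hd hKP
    (c := fun _ => (1 : ℝ)) (fun _ => ⟨zero_le_one, le_rfl⟩) (γ := X) hS
  rw [scaledActivity_one] at hmain
  have hlhs : touchSum (GeomInc R) w (fun _ => (0 : ℝ)) L X =
      ∑ 𝒞 ∈ L.powerset with KPTouches (GeomInc R) 𝒞 X, ‖truncatedWeight (GeomInc R) w 𝒞‖ := by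
    unfold touchSum
    refine sum_congr rfl fun 𝒞 _ => ?_
    simp
  rw [hlhs] at hmain
  refine hmain.trans ?_
  have hsum := geomInc_kp_sum_le hR hΔ hnbr h.nonneg (τ := 0) (by simpa using hsmall) w hz0 hz X
    (L.filter fun Y => GeomInc R Y X) fun Y hY => (mem_filter.1 hY).2
  simpa using hsum

omit [DecidableEq V] [DecidableRel R] [Std.Symm R] in
/-- Every nonempty family of polymers of `C` touches a singleton polymer `{p}`, `p ∈ C`.
[folklore] -/
theorem exists_kpTouches_singleton {C : Finset V} {𝒞 : Finset (Finset V)}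
    (h𝒞 : 𝒞 ⊆ rconnSubsets R C) (hne : 𝒞.Nonempty) :
    ∃ p ∈ C, KPTouches (GeomInc R) 𝒞 {p} := by
  obtain ⟨Y, hY⟩ := hne
  obtain ⟨hYC, hYconn⟩ := mem_rconnSubsets.1 (h𝒞 hY)
  obtain ⟨p, hp⟩ := hYconn.1
  exact ⟨p, hYC hp, Y, hY, Or.inr ⟨p, hp, p, mem_singleton_self p, Or.inl rfl⟩⟩

/-- **Extensivity of `log Z` with an `O(ε)` density**: under `e ε (Δ+1)² ≤ 1/2`,
`‖log Z(C)‖ ≤ #C (Δ+1) 2eε`, uniformly in the volume (every nonempty cluster touches a singleton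
`{p}`, `p ∈ C`, and the clusters pinned at `{p}` weigh at most `(Δ+1) 2eε`).
[cite: KoteckyPreiss1986, Theorem p. 492, (2) and (4); FriedliVelenik2017, §5.7.1] -/
theorem norm_pertLogZ_le [IsProbabilityMeasure μ] (hΔ : ∀ x, (nbr x).card ≤ Δ)
    (hnbr : ∀ x y, R x y → y ∈ nbr x) (h : IsLocalPerturbation μ R 𝓕 g ε)
    (hsmall : Real.exp 1 * ε * ((Δ : ℝ) + 1) ^ 2 ≤ 1 / 2) (C : Finset V) :
    ‖pertLogZ μ g R C‖ ≤ C.card * ((Δ : ℝ) + 1) * (2 * (Real.exp 1 * ε)) := by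
  classical
  set L := rconnSubsets R C with hL
  set Φ : Finset (Finset V) → ℂ := truncatedWeight (GeomInc R) (connActivity R μ g) with hΦ
  rw [pertLogZ_eq_sum_truncatedWeight]
  -- drop the empty family and dominate by the pinned sums
  have hsplit : ∑ 𝒞 ∈ L.powerset, Φ 𝒞 = ∑ 𝒞 ∈ L.powerset with 𝒞.Nonempty, Φ 𝒞 := by
    rw [sum_filter]
    refine sum_congr rfl fun 𝒞 _ => ?_
    split_ifs with hne
    · rfl
    · rw [not_nonempty_iff_eq_empty.1 hne, hΦ, truncatedWeight_empty]
  rw [hsplit]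
  refine (norm_sum_le _ _).trans ?_
  calc ∑ 𝒞 ∈ L.powerset with 𝒞.Nonempty, ‖Φ 𝒞‖
      ≤ ∑ 𝒞 ∈ L.powerset with 𝒞.Nonempty, ∑ p ∈ C with KPTouches (GeomInc R) 𝒞 {p}, ‖Φ 𝒞‖ := by
        refine sum_le_sum fun 𝒞 h𝒞 => ?_
        obtain ⟨h𝒞L, hne⟩ := mem_filter.1 h𝒞
        obtain ⟨p, hpC, hp⟩ := exists_kpTouches_singleton (mem_powerset.1 h𝒞L) hne
        have hmem : p ∈ C.filter fun p => KPTouches (GeomInc R) 𝒞 {p} := mem_filter.2 ⟨hpC, hp⟩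
        calc ‖Φ 𝒞‖ = ∑ q ∈ ({p} : Finset V), ‖Φ 𝒞‖ := by simp
          _ ≤ _ := sum_le_sum_of_subset_of_nonneg (by simpa using hmem) fun _ _ _ => norm_nonneg _
    _ ≤ ∑ 𝒞 ∈ L.powerset, ∑ p ∈ C with KPTouches (GeomInc R) 𝒞 {p}, ‖Φ 𝒞‖ :=
        sum_le_sum_of_subset_of_nonneg (filter_subset _ _) fun _ _ _ =>
          sum_nonneg fun _ _ => norm_nonneg _
    _ = ∑ p ∈ C, ∑ 𝒞 ∈ L.powerset with KPTouches (GeomInc R) 𝒞 {p}, ‖Φ 𝒞‖ := by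
        rw [sum_comm' (t' := C) (s' := fun p => L.powerset.filter fun 𝒞 => KPTouches (GeomInc R) 𝒞 {p})]
        intro 𝒞 p
        simp only [mem_filter]
        tauto
    _ ≤ ∑ p ∈ C, (({p} : Finset V).card : ℝ) * ((Δ : ℝ) + 1) * (2 * (Real.exp 1 * ε)) :=
        sum_le_sum fun p _ => sum_norm_truncatedWeight_touching_le hΔ hnbr h hsmall C {p}
    _ = C.card * ((Δ : ℝ) + 1) * (2 * (Real.exp 1 * ε)) := by
        simp only [card_singleton, Nat.cast_one, one_mul, sum_const, nsmul_eq_mul]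
        ring

end LogZ

end Literature.Probability.LatticeModels
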